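import Literature.Computability.Complexity.UmansFPGenEval
import Literature.Computability.Complexity.UmansFieldSetup
import Literature.Computability.Complexity.UmansFPPredictorSpec
import Mathlib.FieldTheory.Finite.Basic
import Mathlib.FieldTheory.Galois.NormalBasis
import HarnessLib

/-!
# Umans' generator: the field data found by the generator, as mathematics

Literature / circuit complexity — derandomization. The generator `genCoreL` of
`UmansFPGenEval.lean` sets up, by exhaustive search, the finite fields of C. Umans, JCSS 67 (2003),
§3–§4: `K = F_q = GF2 M` (`q = 2^{M+1} = h^{c₀}`, `h = 2ᵃ`), the subfield `F_h`, an irreducible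
`p ∈ F_h[z]` of degree `d` (Lemma 7), `L = K[z]/(p) = F_{q^d}`, a primitive `α` (§4.1), a normal
`β` (Def. 9). This file proves, for VALID parameters (`PrmOK`), that the searches succeed and turns
their outputs into the mathematical objects used by the reconstruction theorem:

* `PrmOK` (the validity of `(cap, a, M, d, c₀)`), `ctxOf_eq` (the context is `kctx M`),
  `HlOf_spec` (the list of `F_h`), `pc_spec` (the modulus: reduced, coefficients in `F_h`,
  irreducible), the field `LF := AdjoinRoot (pOf M pc)` with its instances and cardinality `q^d`,
  `reprL` (canonical representatives), `α_spec` (primitive: order `q^d - 1`), `β_spec` (normal),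
  the power basis `NB` and `lElt_eq_ρN` (program values are `ρN NB`), the Frobenius data.

It then shows (section `Enc`) that, with the field data of valid parameters in hand, the evaluation
programs of `UmansFPGenEval.lean` compute exactly the mathematical objects of the paper: the
Lagrange extension `φ = LDE'_x` of the table placed at the positions `γᵏ` (§4.1, eq. (2), Thm. 8),
the augmented encoding `Ẽ(u) = Σ_τ φ(τ⁻¹u) • τβ` (Def. 9), the `q^d`-ary generator
`Ẽ(αy), …, Ẽ(αᵐy)` (Thm. 14, eq. (7)) and its binary version through the Reed–Solomon–Hadamard
code (Lemma 13):

* `tabK`, `φF`, `EF` (the table, `φ`, `Ẽ` as functions), `φF_pos` (`φ(γᵏ) = x_k`);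
* `elt_ldeEvalL_eq` (**the program computes `φ`**), `lElt_augEvalL_eq` (**the program computes `Ẽ`**),
  `lElt_symbolsL` (the symbols are `qGen`), `cw_list` and `genBitsL_eq_binGen` (the bits are `binGen`).

Everything is proved; no named fact.

## References

* C. Umans, *Pseudo-random generators for all hardnesses*, JCSS 67 (2003), §3 (Lemma 7), §4.1 (eq. (2),
  Thm. 8), §4.2 (Def. 9), §5 (Thm. 14, eq. (7), Lemma 13) [Umans2003].
* R. Lidl, H. Niederreiter, *Finite Fields*, 2nd ed., CUP 1997, Thm. 2.8, §2.3, Thm. 3.46 [LidlNiederreiter1996].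
-/

noncomputable section

namespace Literature.Computability.Complexity

open Polynomial Finset Literature.InformationTheory.Coding
open Literature.InformationTheory.Coding.GF2X

namespace UmansFP

/-! ### Valid parameters -/

/-- **Validity of the parameters** `(cap, a, M, d)` with `c₀ = log_h q`: `q = 2^{M+1} = (2ᵃ)^{c₀}`,
`gcd(c₀, d) = 1`, `d ≥ 1`, and the enumeration cap is inactive (`q^d ≤ cap`). [cite: Umans2003, §3, §5] -/
structure PrmOK (cap a M d c0 : ℕ) : Prop where
  ha : 1 ≤ a
  hM : M + 1 = a * c0
  hd : 1 ≤ d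
  hcop : Nat.Coprime c0 d
  hcap : qOf M ^ d ≤ cap

/-- **The node set `H = F_h ⊆ K`** as a finset. [cite: Umans2003, §3] -/
def HF (cap a M : ℕ) : Finset (GF2 M) := ((HlOf cap a M).map (GF2.elt M)).toFinset

/-- **The extension field `L = K[z]/(p)`.** [cite: Umans2003, §3] -/
abbrev LF (cap a M d : ℕ) : Type := AdjoinRoot (pOf M (pcOf cap a M d))

section Defs

variable {cap a M d : ℕ} [Fact (Irreducible (pOf M (pcOf cap a M d)))]

/-- The power basis of `L` over `K`, indexed by `Fin d` (for a modulus of length `d`). [cite: Umans2003, §3] -/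
def NB (hlen : (pcOf cap a M d).length = d) : Module.Basis (Fin d) (GF2 M) (LF cap a M d) :=
  ((AdjoinRoot.powerBasis' (monic_pOf M (pcOf cap a M d))).basis).reindex
    (finCongr (by rw [AdjoinRoot.powerBasis'_dim, natDegree_pOf, hlen]))

/-- **The canonical reduced representative list** of an element of `L`: its power-basis coordinates as bitmasks.
[cite: Umans2003, §3] -/
def reprL (hlen : (pcOf cap a M d).length = d) (x : LF cap a M d) : List ℕ := List.ofFn fun j : Fin d => toBits M ((NB hlen).repr x j)

/-- Finite-dimensionality instance. [folklore] -/
instance finiteLF : Module.Finite (GF2 M) (LF cap a M d) := (monic_pOf M (pcOf cap a M d)).finite_adjoinRoot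

/-- `L` is finite. [folklore] -/
instance fintypeLF : Fintype (LF cap a M d) := Module.fintypeOfFintype (AdjoinRoot.powerBasis' (monic_pOf M (pcOf cap a M d))).basis

end Defs

namespace PrmOK

section Basic

variable {cap a M d c0 : ℕ} (V : PrmOK cap a M d c0)
include V

/-- `c₀ ≥ 1`. [folklore] -/
theorem hc0 : 1 ≤ c0 := Nat.pos_of_ne_zero fun h0 => by have := V.hM; rw [h0, Nat.mul_zero] at this; omega

/-- `a ≤ M + 1`. [folklore] -/
theorem a_le : a ≤ M + 1 := by rw [V.hM]; exact Nat.le_mul_of_pos_right a V.hc0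

/-- `q ≤ cap`. [folklore] -/
theorem q_le_cap : qOf M ≤ cap := (Nat.le_self_pow (by have := V.hd; omega) _).trans V.hcap

/-- `min q cap = q`. [folklore] -/
theorem min_q : min (qOf M) cap = qOf M := min_eq_left V.q_le_cap

/-- `min (2ᵃ) cap = 2ᵃ`. [folklore] -/
theorem min_h : min (2 ^ a) cap = 2 ^ a := min_eq_left ((Nat.pow_le_pow_right (by norm_num) V.a_le).trans V.q_le_cap)

/-- `min (q^d - 1) cap = q^d - 1`. [folklore] -/
theorem min_P : min (qOf M ^ d - 1) cap = qOf M ^ d - 1 := min_eq_left ((Nat.sub_le _ _).trans V.hcap)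

/-- **The context is `kctx M`** (the search of `f_M` has enough budget). [cite: Umans2003, §3] -/
theorem ctxOf_eq : ctxOf cap M = kctx M := by
  rw [ctxOf, V.min_q, kctx, qOf, irredSearch_eq (Nat.pow_le_pow_right (by norm_num) (Nat.le_succ M))]

end Basic

/-! ### The subfield `F_h` -/

section Hl

variable {cap a M d c0 : ℕ} (V : PrmOK cap a M d c0)
include V

/-- **The list of `F_h`**: the `u < q` with `u^{2ᵃ} = u`. [cite: Umans2003, §3] -/
theorem HlOf_eq : HlOf cap a M = (List.range (2 ^ (M + 1))).filter fun u => kpow M u (2 ^ a) == u := by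
  rw [HlOf, V.min_q, V.min_h, V.ctxOf_eq, qOf]; rfl

/-- Members of the list are reduced. [folklore] -/
theorem HlOf_lt : ∀ x ∈ HlOf cap a M, x < 2 ^ (M + 1) := fun x hx => by
  rw [V.HlOf_eq, List.mem_filter] at hx; exact List.mem_range.1 hx.1

/-- The list is duplicate-free. [folklore] -/
theorem HlOf_nodup : (HlOf cap a M).Nodup := by rw [V.HlOf_eq]; exact (List.nodup_range).filter _

/-- **Membership**: `u ∈ Hl ↔ u < q ∧ elt(u)^{2ᵃ} = elt(u)`. [cite: Umans2003, §3] -/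
theorem mem_HlOf {u : ℕ} : u ∈ HlOf cap a M ↔ u < 2 ^ (M + 1) ∧ GF2.elt M u ^ (2 ^ a) = GF2.elt M u := by
  rw [V.HlOf_eq, List.mem_filter, List.mem_range, beq_iff_eq]
  constructor
  · rintro ⟨hu, hk⟩
    obtain ⟨h1, h2⟩ := kpow_spec M hu (2 ^ a)
    exact ⟨hu, by rw [← h1, hk]⟩
  · rintro ⟨hu, hfix⟩
    obtain ⟨h1, h2⟩ := kpow_spec M hu (2 ^ a)
    exact ⟨hu, GF2.elt_injective h2 hu (h1.trans hfix)⟩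

/-- `0 ∈ Hl`, so the list is nonempty. [folklore] -/
theorem HlOf_length_pos : 1 ≤ (HlOf cap a M).length :=
  List.length_pos_of_mem (V.mem_HlOf.2 ⟨Nat.two_pow_pos _, by rw [GF2.elt, bitsPoly_zero, map_zero, zero_pow (Nat.two_pow_pos _).ne']⟩)

/-- The list has at most `q` members. [folklore] -/
theorem HlOf_length_le : (HlOf cap a M).length ≤ 2 ^ (M + 1) := by
  rw [V.HlOf_eq]; exact (List.length_filter_le _ _).trans (by rw [List.length_range])

/-- Membership in `H`. [cite: Umans2003, §3] -/
theorem mem_HF {x : GF2 M} : x ∈ HF cap a M ↔ x ^ (2 ^ a) = x := by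
  rw [HF, List.mem_toFinset, List.mem_map]
  constructor
  · rintro ⟨u, hu, rfl⟩; exact (V.mem_HlOf.1 hu).2
  · intro hx; exact ⟨toBits M x, V.mem_HlOf.2 ⟨toBits_lt M x, by rw [elt_toBits]; exact hx⟩, elt_toBits M x⟩

/-- **`|H| ≤ h`** (roots of `X^h - X`). [cite: LidlNiederreiter1996, Thm. 3.46 (subfields)] -/
theorem card_HF_le : (HF cap a M).card ≤ 2 ^ a := by
  classical
  set R : (GF2 M)[X] := X ^ (2 ^ a) - X with hR
  have h1 : 1 < 2 ^ a := Nat.one_lt_two_pow (by have := V.ha; omega)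
  have hR0 : R ≠ 0 := FiniteField.X_pow_card_sub_X_ne_zero (GF2 M) h1
  have hdeg : R.natDegree = 2 ^ a := FiniteField.X_pow_card_sub_X_natDegree_eq (GF2 M) h1
  have hsub : HF cap a M ⊆ R.roots.toFinset := fun x hx => by
    rw [Multiset.mem_toFinset, mem_roots hR0, IsRoot.def, hR, eval_sub, eval_pow, eval_X, V.mem_HF.1 hx, sub_self]
  exact (card_le_card hsub).trans ((Multiset.toFinset_card_le _).trans ((card_roots' R).trans hdeg.le))

end Hl

/-! ### The modulus -/

section Modulus

variable {cap a M d c0 : ℕ} (V : PrmOK cap a M d c0)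
include V

/-- **The modulus found by the search**: a reduced list of length `d` with entries in `F_h` whose
`pOf` is irreducible over `K`. [cite: Umans2003, §3, Lemma 7] -/
theorem pc_spec : LRep M d (pcOf cap a M d) ∧ (∀ x ∈ pcOf cap a M d, x ∈ HlOf cap a M) ∧ Irreducible (pOf M (pcOf cap a M d)) := by
  have hHl := V.HlOf_lt
  have hcapH : (HlOf cap a M).length ^ d ≤ cap := (Nat.pow_le_pow_left V.HlOf_length_le d).trans (by rw [← qOf]; exact V.hcap)
  have hcap2 : (2 ^ (M + 1)) ^ (d / 2) ≤ cap := (Nat.pow_le_pow_right Nat.one_le_two_pow (Nat.div_le_self d 2)).trans (by rw [← qOf]; exact V.hcap)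
  -- existence from Lemma 7
  have hex : ∃ pc ∈ vecsOverL cap (HlOf cap a M) d, Irreducible (pOf M pc) := by
    obtain ⟨g, hmon, hdeg, hirr, hfix⟩ := UmansField.exists_irreducible_fixed_GF2 M V.hM V.ha V.hd V.hcop
    refine ⟨coeffListL M d g, (mem_vecsOverL V.HlOf_length_pos hcapH).2 ⟨List.length_ofFn, fun x hx => ?_⟩, by rw [pOf_coeffListL hmon hdeg]; exact hirr⟩
    obtain ⟨i, rfl⟩ := List.mem_ofFn.1 hx
    exact V.mem_HlOf.2 ⟨toBits_lt M _, by rw [elt_toBits]; exact hfix i⟩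
  have h := findIrredL_spec hHl V.HlOf_length_pos V.hd hcapH hcap2 hex
  rw [pcOf, V.ctxOf_eq, V.min_q, qOf]
  obtain ⟨hmem, hirr⟩ := h
  obtain ⟨hlen, hin⟩ := (mem_vecsOverL V.HlOf_length_pos hcapH).1 hmem
  exact ⟨⟨hlen, fun x hx => hHl x (hin x hx)⟩, hin, hirr⟩

end Modulus

/-! ### The field `L` -/

section FieldL

variable {cap a M d c0 : ℕ}

/-- Irreducibility as a `Fact` (from valid parameters). [cite: Umans2003, §3, Lemma 7] -/
theorem fact_irreducible (V : PrmOK cap a M d c0) : Fact (Irreducible (pOf M (pcOf cap a M d))) := ⟨V.pc_spec.2.2⟩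

variable [hirr : Fact (Irreducible (pOf M (pcOf cap a M d)))]

/-- The power basis vectors are the powers of the root. [cite: Umans2003, §3] -/
theorem NB_apply (hlen : (pcOf cap a M d).length = d) (j : Fin d) : NB hlen j = AdjoinRoot.root (pOf M (pcOf cap a M d)) ^ (j : ℕ) := by
  rw [NB, Module.Basis.reindex_apply, PowerBasis.coe_basis, AdjoinRoot.powerBasis'_gen]
  simp

/-- `L` is finite-dimensional of dimension `d`. [cite: Umans2003, §3] -/
theorem finrank_LF (hlen : (pcOf cap a M d).length = d) : Module.finrank (GF2 M) (LF cap a M d) = d := by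
  rw [Module.finrank_eq_card_basis (NB hlen), Fintype.card_fin]

/-- **`|L| = q^d`.** [cite: Umans2003, §3] -/
theorem card_LF (hlen : (pcOf cap a M d).length = d) : Fintype.card (LF cap a M d) = (2 ^ (M + 1)) ^ d := by
  rw [Module.card_fintype (NB hlen), card_GF2, Fintype.card_fin]

/-! ### Canonical representatives -/

/-- The representative is reduced of length `d`. [folklore] -/
theorem reprL_rep (hlen : (pcOf cap a M d).length = d) (x : LF cap a M d) : LRep M d (reprL hlen x) :=
  ⟨List.length_ofFn, fun y hy => by obtain ⟨j, rfl⟩ := List.mem_ofFn.1 hy; exact toBits_lt M _⟩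

/-- **A reduced list of length `≤ d` evaluates to the combination of basis vectors with its entries as
coordinates**: `lElt u = Σ_j elt(u_j) • N_j = ρN N u`. [cite: Umans2003, §3] -/
theorem lElt_eq_ρN (hlen : (pcOf cap a M d).length = d) {u : List ℕ} (hu : u.length ≤ d) :
    lElt M (pcOf cap a M d) u = ρN (NB hlen) u := by
  set f : ℕ → LF cap a M d := fun j => AdjoinRoot.of (pOf M (pcOf cap a M d)) (GF2.elt M (u.getD j 0)) * AdjoinRoot.root (pOf M (pcOf cap a M d)) ^ j with hf
  have hL : lElt M (pcOf cap a M d) u = ∑ j ∈ Finset.range u.length, f j := by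
    rw [lElt, polyOfList, map_sum]
    refine Finset.sum_congr rfl fun j _ => ?_
    rw [map_mul, map_pow, AdjoinRoot.mk_C, AdjoinRoot.mk_X]
  have hR : ρN (NB hlen) u = ∑ j ∈ Finset.range d, f j := by
    rw [ρN, vecToL, ← Fin.sum_univ_eq_sum_range f d]
    refine Finset.sum_congr rfl fun j _ => ?_
    rw [Algebra.smul_def, AdjoinRoot.algebraMap_eq, NB_apply]
  rw [hL, hR]
  refine (Finset.sum_subset (Finset.range_subset_range.2 hu) fun j hj hj' => ?_)
  have hge : u.length ≤ j := by rw [Finset.mem_range] at hj hj'; omega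
  rw [hf]; simp only []
  rw [List.getD_eq_default _ _ hge, GF2.elt, bitsPoly_zero, map_zero, map_zero, zero_mul]

/-- Coordinates of a represented element are the entries. [cite: Umans2003, §3] -/
theorem coord_lElt (hlen : (pcOf cap a M d).length = d) {u : List ℕ} (hu : u.length ≤ d) (j : Fin d) :
    (NB hlen).coord j (lElt M (pcOf cap a M d) u) = GF2.elt M (u.getD j 0) := by
  rw [lElt_eq_ρN hlen hu, ρN, coord_vecToL]

/-- **`reprL` represents**: `lElt (reprL x) = x`. [cite: Umans2003, §3] -/
theorem lElt_reprL (hlen : (pcOf cap a M d).length = d) (x : LF cap a M d) : lElt M (pcOf cap a M d) (reprL hlen x) = x := by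
  rw [lElt_eq_ρN hlen (by rw [(reprL_rep hlen x).1]), ρN, vecToL]
  conv_rhs => rw [← (NB hlen).sum_repr x]
  refine Finset.sum_congr rfl fun j _ => ?_
  rw [reprL, List.getD_eq_getElem _ _ (by rw [List.length_ofFn]; exact j.2), List.getElem_ofFn, elt_toBits]

end FieldL

/-! ### The primitive element -/

section Alpha

variable {cap a M d c0 : ℕ} [hirr : Fact (Irreducible (pOf M (pcOf cap a M d)))]

/-- **`α` as an element of `L`.** [cite: Umans2003, §4.1] -/
def _root_.Literature.Computability.Complexity.UmansFP.αL (cap a M d : ℕ) [Fact (Irreducible (pOf M (pcOf cap a M d)))] : LF cap a M d :=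
  lElt M (pcOf cap a M d) (αOf cap a M d)

variable (V : PrmOK cap a M d c0)
include V

omit hirr in
/-- The modulus has length `d`. [folklore] -/
theorem hlen : (pcOf cap a M d).length = d := V.pc_spec.1.1

/-- **The primitive element found by the search**: reduced, nonzero, no power below `q^d - 1` is `1`.
[cite: Umans2003, §4.1; LidlNiederreiter1996, Thm. 2.8] -/
theorem α_spec : LRep M d (αOf cap a M d) ∧ lElt M (pcOf cap a M d) (αOf cap a M d) ≠ 0 ∧
    ∀ k, 1 ≤ k → k < (2 ^ (M + 1)) ^ d - 1 → lElt M (pcOf cap a M d) (αOf cap a M d) ^ k ≠ 1 := by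
  have hpc := V.pc_spec.1
  have hcap : (2 ^ (M + 1)) ^ d ≤ cap := by rw [← qOf]; exact V.hcap
  -- existence: a generator of the cyclic group of units
  have hex : ∃ u : List ℕ, LRep M d u ∧ lElt M (pcOf cap a M d) u ≠ 0 ∧
      ∀ k, 1 ≤ k → k < (2 ^ (M + 1)) ^ d - 1 → lElt M (pcOf cap a M d) u ^ k ≠ 1 := by
    obtain ⟨ζ, hζ⟩ := IsCyclic.exists_ofOrder_eq_natCard (α := (LF cap a M d)ˣ)
    have hcard : Nat.card (LF cap a M d)ˣ = (2 ^ (M + 1)) ^ d - 1 := by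
      rw [Nat.card_units, Nat.card_eq_fintype_card, card_LF V.hlen]
    refine ⟨reprL V.hlen (ζ : LF cap a M d), reprL_rep V.hlen _, by rw [lElt_reprL]; exact ζ.ne_zero, fun k hk1 hk2 h1 => ?_⟩
    rw [lElt_reprL, ← Units.val_pow_eq_pow_val, ← Units.val_one, Units.val_inj] at h1
    have := orderOf_dvd_of_pow_eq_one h1
    rw [hζ, hcard] at this
    exact absurd (Nat.le_of_dvd hk1 this) (by omega)
  have h := findPrimL_spec hpc V.hd hcap hex
  rw [αOf, V.ctxOf_eq, V.min_q, V.min_P, qOf]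
  exact h

/-- `α ≠ 0`. [cite: Umans2003, §4.1] -/
theorem αL_ne_zero : αL cap a M d ≠ 0 := V.α_spec.2.1

/-- **`α^{q^d - 1} = 1`.** [cite: Umans2003, §4.1] -/
theorem αL_pow_P : αL cap a M d ^ ((2 ^ (M + 1)) ^ d - 1) = 1 := by
  have := FiniteField.pow_card_sub_one_eq_one (αL cap a M d) V.αL_ne_zero
  rwa [card_LF V.hlen] at this

/-- **The powers `α⁰, …, α^{P-1}` are distinct** (`P = q^d - 1`). [cite: Umans2003, §4.1] -/
theorem αL_pow_injOn {i j : ℕ} (hi : i < (2 ^ (M + 1)) ^ d - 1) (hj : j < (2 ^ (M + 1)) ^ d - 1) (h : αL cap a M d ^ i = αL cap a M d ^ j) : i = j := by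
  by_contra hne
  wlog hlt : i < j generalizing i j
  · exact this hj hi h.symm (Ne.symm hne) (lt_of_le_of_ne (not_lt.1 hlt) (Ne.symm hne))
  have hk : αL cap a M d ^ (j - i) = 1 := by
    have e : αL cap a M d ^ i * αL cap a M d ^ (j - i) = αL cap a M d ^ i * 1 := by rw [← pow_add, Nat.add_sub_cancel' hlt.le, ← h, mul_one]
    exact mul_left_cancel₀ (pow_ne_zero _ V.αL_ne_zero) e
  exact V.α_spec.2.2 (j - i) (by omega) (by omega) hk

/-- **Every nonzero element is a power of `α`** (below `P`). [cite: Umans2003, §4.1] -/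
theorem αL_gen (x : LF cap a M d) (hx : x ≠ 0) : ∃ k, k < (2 ^ (M + 1)) ^ d - 1 ∧ αL cap a M d ^ k = x := by
  classical
  set P := (2 ^ (M + 1)) ^ d - 1 with hP
  have himg : ((Finset.range P).image fun k => αL cap a M d ^ k) = univ.filter fun y : LF cap a M d => y ≠ 0 := by
    apply eq_of_subset_of_card_le
    · intro y hy
      obtain ⟨k, -, rfl⟩ := mem_image.1 hy
      exact mem_filter.2 ⟨mem_univ _, pow_ne_zero _ V.αL_ne_zero⟩
    · rw [card_image_of_injOn fun i hi j hj h => V.αL_pow_injOn (mem_range.1 hi) (mem_range.1 hj) h, card_range,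
        filter_ne' univ (0 : LF cap a M d), card_erase_of_mem (mem_univ _), card_univ, card_LF V.hlen]
  have hmem : x ∈ univ.filter fun y : LF cap a M d => y ≠ 0 := mem_filter.2 ⟨mem_univ _, hx⟩
  rw [← himg, mem_image] at hmem
  obtain ⟨k, hk, rfl⟩ := hmem
  exact ⟨k, mem_range.1 hk, rfl⟩

end Alpha

/-! ### The Frobenius automorphism and the Galois group -/

section Frob

variable {cap a M d c0 : ℕ} [hirr : Fact (Irreducible (pOf M (pcOf cap a M d)))]

/-- **The Frobenius automorphism** `x ↦ x^q` of `L/K`. [cite: Umans2003, §3 ("`σ` the Frobenius")] -/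
def _root_.Literature.Computability.Complexity.UmansFP.frob (cap a M d : ℕ) [Fact (Irreducible (pOf M (pcOf cap a M d)))] : Gal(LF cap a M d / GF2 M) :=
  FiniteField.frobeniusAlgEquivOfAlgebraic (GF2 M) (LF cap a M d)

/-- The Frobenius powers act as `x ↦ x^{q^n}`. [cite: Umans2003, §3] -/
theorem _root_.Literature.Computability.Complexity.UmansFP.frob_pow_apply (n : ℕ) (x : LF cap a M d) : (frob cap a M d ^ n) x = x ^ ((2 ^ (M + 1)) ^ n) := by
  rw [frob, AlgEquiv.coe_pow, FiniteField.coe_frobeniusAlgEquivOfAlgebraic_iterate, card_GF2]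

variable (V : PrmOK cap a M d c0)
include V

/-- **The Frobenius has order `d`** (`σ^d = 1`). [cite: Umans2003, §3] -/
theorem frob_pow_d : frob cap a M d ^ d = 1 := by
  have := FiniteField.orderOf_frobeniusAlgEquivOfAlgebraic (GF2 M) (LF cap a M d)
  rw [finrank_LF V.hlen] at this
  have h1 := pow_orderOf_eq_one (FiniteField.frobeniusAlgEquivOfAlgebraic (GF2 M) (LF cap a M d))
  rw [this] at h1
  exact h1

/-- `x^{q^d} = x`. [folklore] -/
theorem pow_q_pow_d (x : LF cap a M d) : x ^ ((2 ^ (M + 1)) ^ d) = x := by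
  rw [← frob_pow_apply, V.frob_pow_d, AlgEquiv.one_apply]

/-- **The Galois group is `{σⁿ : n < d}`** (bijectively). [cite: Umans2003, §3] -/
theorem frob_pow_bijective : Function.Bijective fun n : Fin d => frob cap a M d ^ (n : ℕ) := by
  have h := FiniteField.bijective_frobeniusAlgEquivOfAlgebraic_pow (GF2 M) (LF cap a M d)
  rw [finrank_LF V.hlen] at h
  exact h

/-- The bijection `Fin d ≃ Gal(L/K)`, `n ↦ σⁿ`. [cite: Umans2003, §3] -/
def galEquiv : Fin d ≃ Gal(LF cap a M d / GF2 M) := Equiv.ofBijective _ V.frob_pow_bijective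

/-- The bijection is `n ↦ σⁿ`. [folklore] -/
theorem galEquiv_apply (n : Fin d) : V.galEquiv n = frob cap a M d ^ (n : ℕ) := rfl

/-- The inverse of `σⁿ` is `σ^{d-n}`. [folklore] -/
theorem frob_pow_symm (n : Fin d) (x : LF cap a M d) : (frob cap a M d ^ (n : ℕ)).symm x = (frob cap a M d ^ (d - (n : ℕ))) x := by
  apply (frob cap a M d ^ (n : ℕ)).injective
  rw [AlgEquiv.apply_symm_apply, ← AlgEquiv.mul_apply, ← pow_add, Nat.add_sub_cancel' n.2.le, V.frob_pow_d, AlgEquiv.one_apply]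

end Frob

/-! ### The normal element -/

section Beta

variable {cap a M d c0 : ℕ} [hirr : Fact (Irreducible (pOf M (pcOf cap a M d)))]

/-- **`β` as an element of `L`.** [cite: Umans2003, §4.2, Def. 9] -/
def _root_.Literature.Computability.Complexity.UmansFP.βL (cap a M d : ℕ) [Fact (Irreducible (pOf M (pcOf cap a M d)))] : LF cap a M d :=
  lElt M (pcOf cap a M d) (βOf cap a M d)

variable (V : PrmOK cap a M d c0)
include V

omit V in
/-- The dot product of two lists of length `d` as a `Fin d` sum. [folklore] -/
theorem dot_eq_sum {l v : List (GF2 M)} (hl : l.length = d) (hv : v.length = d) :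
    Literature.LinearAlgebra.Matrix.ListGauss.dot l v = ∑ i : Fin d, l.getD i 0 * v.getD i 0 := by
  have h := Literature.LinearAlgebra.Matrix.ListGauss.dot_ofFn_left (fun i : Fin d => l.getD i 0) v hv
  have hl' : List.ofFn (fun i : Fin d => l.getD i 0) = l := by
    apply List.ext_getElem (by rw [List.length_ofFn, hl]) fun i h1 h2 => ?_
    rw [List.getElem_ofFn, List.getD_eq_getElem _ _ h2]
  rw [hl'] at h
  rw [h]

/-- **The coordinate matrix of the Frobenius orbit** of `x`: row `j` = coordinates of `x^{q^j}`. [cite: Umans2003, §4.2, Def. 9] -/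
def frobMat (x : LF cap a M d) : Matrix (Fin d) (Fin d) (GF2 M) := fun j i => (NB V.hlen).coord i (x ^ ((2 ^ (M + 1)) ^ (j : ℕ)))

/-- **The machine's normality test decides invertibility of the orbit matrix** (on a representative).
[cite: LidlNiederreiter1996, §2.3] -/
theorem isNormalL_iff_injective (x : LF cap a M d) :
    isNormalL (kctx M) (pcOf cap a M d) (reprL V.hlen x) (M + 1) = true ↔ Function.Injective (V.frobMat x).mulVec := by
  have hpc := V.pc_spec.1
  have hu := reprL_rep V.hlen x
  obtain ⟨hrl, hrows⟩ := frobRowsL_spec hpc V.hd hu (M + 1)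
  -- the rows of the machine are the rows of the matrix
  have hrow : ∀ j : Fin d, castVec M ((frobRowsL (kctx M) (pcOf cap a M d) (reprL V.hlen x) (M + 1)).getD j []) =
      List.ofFn fun i : Fin d => V.frobMat x j i := by
    intro j
    obtain ⟨hrep, hval⟩ := hrows j j.2
    obtain ⟨hlenr, -⟩ := hrep
    apply List.ext_getElem (by rw [length_castVec, hlenr, List.length_ofFn]) fun i h1 h2 => ?_
    rw [List.length_ofFn] at h2
    rw [List.getElem_ofFn, frobMat]
    have hi : i < ((frobRowsL (kctx M) (pcOf cap a M d) (reprL V.hlen x) (M + 1)).getD j []).length := by rw [hlenr]; exact h2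
    simp only [castVec, List.getElem_map]
    rw [← List.getD_eq_getElem _ 0 hi, ← coord_lElt V.hlen hlenr.le ⟨i, h2⟩, hval, lElt_reprL, ← pow_mul]
  rw [isNormalL_iff hpc V.hd hu]
  constructor
  · intro h v w hvw
    -- `A (v - w) = 0`
    have h0 : (V.frobMat x).mulVec (v - w) = 0 := by rw [Matrix.mulVec_sub, hvw, sub_self]
    have hz := h (List.ofFn (v - w)) List.length_ofFn (fun r hr => by
      obtain ⟨k, hk, rfl⟩ := List.getElem_of_mem hr
      rw [hrl] at hk
      rw [← List.getD_eq_getElem _ [] (by rw [hrl]; exact hk), hrow ⟨k, hk⟩, Literature.LinearAlgebra.Matrix.ListGauss.dot_ofFn]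
      have := congrFun h0 ⟨k, hk⟩
      rw [Matrix.mulVec, Pi.zero_apply] at this
      exact this)
    funext i
    have := hz ((v - w) i) (List.mem_ofFn.2 ⟨i, rfl⟩)
    rwa [Pi.sub_apply, sub_eq_zero] at this
  · intro hinj v hv horth y hy
    set vf : Fin d → GF2 M := fun i => v.getD i 0 with hvf
    have h0 : (V.frobMat x).mulVec vf = 0 := by
      funext j
      rw [Pi.zero_apply, Matrix.mulVec]
      have := horth _ (by rw [List.getD_eq_getElem _ [] (by rw [hrl]; exact j.2)]; exact List.getElem_mem _ : (frobRowsL (kctx M) (pcOf cap a M d) (reprL V.hlen x) (M + 1)).getD j [] ∈ _)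
      rw [hrow j, Literature.LinearAlgebra.Matrix.ListGauss.dot_ofFn_left _ _ hv] at this
      exact this
    have hvz : vf = 0 := hinj (by rw [h0, Matrix.mulVec_zero])
    obtain ⟨i, hi, rfl⟩ := List.getElem_of_mem hy
    have := congrFun hvz ⟨i, by rw [← hv]; exact hi⟩
    rw [hvf] at this; simp only [Pi.zero_apply] at this
    rwa [List.getD_eq_getElem _ 0 hi] at this

/-- Invertibility of the orbit matrix is linear independence of the orbit `x, x^q, …`. [cite: LidlNiederreiter1996, §2.3] -/
theorem injective_iff_linearIndependent (x : LF cap a M d) :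
    Function.Injective (V.frobMat x).mulVec ↔ LinearIndependent (GF2 M) fun j : Fin d => x ^ ((2 ^ (M + 1)) ^ (j : ℕ)) := by
  rw [Matrix.mulVec_injective_iff_isUnit, ← Matrix.linearIndependent_rows_iff_isUnit]
  -- rows are the coordinate vectors: transport along the linear equivalence `(Fin d → K) ≃ L`
  set e : (Fin d → GF2 M) ≃ₗ[GF2 M] LF cap a M d :=
    (Finsupp.linearEquivFunOnFinite (GF2 M) (GF2 M) (Fin d)).symm.trans (NB V.hlen).repr.symm with he
  have hrow : (V.frobMat x).row = fun j : Fin d => e.symm (x ^ ((2 ^ (M + 1)) ^ (j : ℕ))) := by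
    funext j i
    rw [he]; rfl
  rw [hrow]
  exact e.symm.toLinearMap.linearIndependent_iff (v := fun j : Fin d => x ^ ((2 ^ (M + 1)) ^ (j : ℕ))) e.symm.ker
/-- **The normal element found by the search**: reduced, and its Frobenius orbit is linearly independent.
[cite: Umans2003, §4.2, Def. 9; LidlNiederreiter1996, §2.3 (normal basis theorem)] -/
theorem β_spec : LRep M d (βOf cap a M d) ∧
    LinearIndependent (GF2 M) fun j : Fin d => lElt M (pcOf cap a M d) (βOf cap a M d) ^ ((2 ^ (M + 1)) ^ (j : ℕ)) := by
  have hpc := V.pc_spec.1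
  have hcap : (2 ^ (M + 1)) ^ d ≤ cap := by rw [← qOf]; exact V.hcap
  -- existence: the normal basis theorem
  have hex : ∃ u : List ℕ, LRep M d u ∧ isNormalL (kctx M) (pcOf cap a M d) u (M + 1) = true := by
    obtain ⟨x, hx⟩ := exists_linearIndependent_algEquiv_apply (GF2 M) (LF cap a M d)
    refine ⟨reprL V.hlen x, reprL_rep V.hlen x, (V.isNormalL_iff_injective x).2 ((V.injective_iff_linearIndependent x).2 ?_)⟩
    have := hx.comp _ V.galEquiv.injective
    convert this using 1
    funext j
    rw [Function.comp_apply, galEquiv_apply, frob_pow_apply]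
  have h := findNormalL_spec hpc hcap hex
  have hβ : βOf cap a M d = findNormalL (kctx M) cap (2 ^ (M + 1)) (pcOf cap a M d) (M + 1) := by
    rw [βOf, V.ctxOf_eq, V.min_q, qOf]
  rw [hβ]
  obtain ⟨hrep, htest⟩ := h
  refine ⟨hrep, ?_⟩
  have hx : reprL V.hlen (lElt M (pcOf cap a M d) (findNormalL (kctx M) cap (2 ^ (M + 1)) (pcOf cap a M d) (M + 1))) =
      findNormalL (kctx M) cap (2 ^ (M + 1)) (pcOf cap a M d) (M + 1) :=
    lElt_injOn hpc (reprL_rep V.hlen _) hrep (lElt_reprL V.hlen _)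
  rw [← hx] at htest
  exact (V.injective_iff_linearIndependent _).1 ((V.isNormalL_iff_injective _).1 htest)

/-- The Galois orbit of `β` is linearly independent. [cite: Umans2003, §4.2, Def. 9] -/
theorem βL_linearIndependent : LinearIndependent (GF2 M) fun τ : Gal(LF cap a M d / GF2 M) => τ (βL cap a M d) := by
  have h := V.β_spec.2
  have h' : LinearIndependent (GF2 M) ((fun τ : Gal(LF cap a M d / GF2 M) => τ (βL cap a M d)) ∘ V.galEquiv) := by
    convert h using 1
    funext j
    rw [Function.comp_apply, galEquiv_apply, frob_pow_apply, βL]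
  exact (linearIndependent_equiv V.galEquiv).1 h'

/-- **The normal basis `(τ β)_τ`.** [cite: Umans2003, §4.2, Def. 9 (normal basis)] -/
def NN : Module.Basis Gal(LF cap a M d / GF2 M) (GF2 M) (LF cap a M d) :=
  Module.Basis.mk V.βL_linearIndependent (by
    rw [V.βL_linearIndependent.span_eq_top_of_card_eq_finrank'
      (Nat.card_eq_fintype_card.symm.trans (IsGalois.card_aut_eq_finrank (GF2 M) (LF cap a M d)))])

/-- The normal basis vectors. [cite: Umans2003, §4.2, Def. 9] -/
theorem NN_apply (τ : Gal(LF cap a M d / GF2 M)) : V.NN τ = τ (βL cap a M d) := by rw [NN, Module.Basis.mk_apply]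

end Beta

/-! ### The subfield `F_h` of `K` and the grid -/

section Grid

variable {cap a M d c0 : ℕ} [hirr : Fact (Irreducible (pOf M (pcOf cap a M d)))]
variable (V : PrmOK cap a M d c0)
include V

omit hirr in
/-- **`|H| = h`**: `X^h - X` divides `X^q - X`, which splits with distinct roots in `K`.
[cite: LidlNiederreiter1996, Thm. 3.46 (subfield criterion)] -/
theorem card_HF : (HF cap a M).card = 2 ^ a := by
  classical
  haveI : CharP (GF2 M) 2 := GF2.charP M
  refine le_antisymm V.card_HF_le ?_
  -- the roots of `X^h - X`: it divides `X^q - X = Π_{x ∈ K} (X - x)`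
  set f : (GF2 M)[X] := X ^ (2 ^ a) - X with hf
  have h1 : 1 < 2 ^ a := Nat.one_lt_two_pow (by have := V.ha; omega)
  have hf0 : f ≠ 0 := FiniteField.X_pow_card_sub_X_ne_zero (GF2 M) h1
  have hdeg : f.natDegree = 2 ^ a := FiniteField.X_pow_card_sub_X_natDegree_eq (GF2 M) h1
  have hsep : f.Separable := galois_poly_separable 2 (2 ^ a) (dvd_pow_self 2 (by have := V.ha; omega))
  have hdvd : f ∣ (X ^ Fintype.card (GF2 M) - X : (GF2 M)[X]) := by
    rw [card_GF2, V.hM, pow_mul, hf]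
    -- `X^h - X ∣ X^{h^c} - X`
    have key : ∀ c : ℕ, (X ^ (2 ^ a) - X : (GF2 M)[X]) ∣ X ^ ((2 ^ a) ^ (c + 1)) - X := by
      intro c
      induction c with
      | zero => rw [zero_add, pow_one]
      | succ c ih =>
        -- `X^{h^{c+2}} - X = (X^{h^{c+1}})^h - X^h + (X^h - X)`
        have e : (X ^ ((2 ^ a) ^ (c + 1 + 1)) - X : (GF2 M)[X]) = ((X ^ ((2 ^ a) ^ (c + 1))) ^ (2 ^ a) - X ^ (2 ^ a)) + (X ^ (2 ^ a) - X) := by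
          rw [pow_succ ((2 : ℕ) ^ a) (c + 1), pow_mul]; ring
        rw [e]
        refine dvd_add ?_ dvd_rfl
        have := sub_dvd_pow_sub_pow (X ^ ((2 ^ a) ^ (c + 1))) (X : (GF2 M)[X]) (2 ^ a)
        exact dvd_trans ih this
    obtain ⟨c, hc⟩ : ∃ c, c0 = c + 1 := ⟨c0 - 1, by have := V.hc0; omega⟩
    rw [hc]; exact key c
  have hsplit : Splits f := by
    have hg : Splits (X ^ Fintype.card (GF2 M) - X : (GF2 M)[X]) := by
      have := FiniteField.splits_X_pow_card_sub_X (p := 2) (K := GF2 M)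
      simpa [Polynomial.map_sub, Polynomial.map_pow, Polynomial.map_X] using this
    exact Splits.of_dvd hg (FiniteField.X_pow_card_sub_X_ne_zero _ Fintype.one_lt_card) hdvd
  have hcard : f.roots.card = 2 ^ a := by rw [← hdeg]; exact (Splits.natDegree_eq_card_roots hsplit).symm
  have hnd : f.roots.Nodup := nodup_roots hsep
  have hsub : f.roots.toFinset ⊆ HF cap a M := fun x hx => by
    rw [Multiset.mem_toFinset, mem_roots hf0, IsRoot.def, hf, eval_sub, eval_pow, eval_X, sub_eq_zero] at hx
    exact V.mem_HF.2 hx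
  calc 2 ^ a = f.roots.toFinset.card := by rw [Multiset.toFinset_card_of_nodup hnd, hcard]
    _ ≤ (HF cap a M).card := card_le_card hsub

/-- The coefficients of the modulus are fixed by `x ↦ x^h` (in `L`). [cite: Umans2003, §3, Lemma 7] -/
theorem coeff_pOf_pow (j : ℕ) : ((pOf M (pcOf cap a M d)).map (algebraMap (GF2 M) (LF cap a M d))).coeff j ^ (2 ^ a) =
    ((pOf M (pcOf cap a M d)).map (algebraMap (GF2 M) (LF cap a M d))).coeff j := by
  obtain ⟨hrep, hin, -⟩ := V.pc_spec
  rw [coeff_map, ← map_pow]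
  congr 1
  rw [pOf, coeff_add, coeff_X_pow, coeff_polyOfList]
  split_ifs with h1 h2 h2
  · omega
  · rw [add_zero, one_pow]
  · rw [zero_add]
    exact (V.mem_HlOf.1 (hin _ (by rw [List.getD_eq_getElem _ _ h2]; exact List.getElem_mem _))).2
  · rw [add_zero, zero_pow (Nat.two_pow_pos _).ne']

/-- **The roots of the modulus in `L` are the conjugates `root^{q^j}`.** [cite: Umans2003, §3, Lemma 7] -/
theorem root_of_eval_eq_zero {y : LF cap a M d} (hy : ((pOf M (pcOf cap a M d)).map (algebraMap (GF2 M) (LF cap a M d))).eval y = 0) :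
    ∃ j : Fin d, y = (frob cap a M d ^ (j : ℕ)) (AdjoinRoot.root (pOf M (pcOf cap a M d))) := by
  classical
  set pL := (pOf M (pcOf cap a M d)).map (algebraMap (GF2 M) (LF cap a M d)) with hpL
  have hpL0 : pL ≠ 0 := (monic_pOf M _).map _ |>.ne_zero
  have hdeg : pL.natDegree = d := by rw [hpL, natDegree_map_eq_of_injective (algebraMap (GF2 M) (LF cap a M d)).injective, natDegree_pOf, V.hlen]
  -- the conjugates are `d` distinct roots
  set conj : Fin d → LF cap a M d := fun j => (frob cap a M d ^ (j : ℕ)) (AdjoinRoot.root (pOf M (pcOf cap a M d))) with hconj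
  have heval : ∀ z : LF cap a M d, pL.eval z = aeval z (pOf M (pcOf cap a M d)) := fun z => by rw [hpL, eval_map, ← aeval_def]
  have hroots : ∀ j : Fin d, pL.eval (conj j) = 0 := fun j => by
    rw [heval, hconj]
    simp only []
    rw [← AlgEquiv.coe_toAlgHom, aeval_algHom_apply, AdjoinRoot.aeval_eq, AdjoinRoot.mk_self, map_zero]
  have hinj : Function.Injective conj := by
    intro j j' h
    have heq : frob cap a M d ^ (j : ℕ) = frob cap a M d ^ (j' : ℕ) := by
      apply AlgEquiv.coe_toAlgHom_injective
      exact AdjoinRoot.algHom_ext h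
    exact V.frob_pow_bijective.1 heq
  have hfull : univ.image conj = pL.roots.toFinset := by
    apply eq_of_subset_of_card_le
    · intro y hy'
      obtain ⟨j, -, rfl⟩ := mem_image.1 hy'
      rw [Multiset.mem_toFinset, mem_roots hpL0, IsRoot.def]; exact hroots j
    · rw [card_image_of_injective _ hinj, card_univ, Fintype.card_fin]
      exact (Multiset.toFinset_card_le _).trans ((card_roots' pL).trans hdeg.le)
  have hmem : y ∈ pL.roots.toFinset := by rw [Multiset.mem_toFinset, mem_roots hpL0, IsRoot.def]; exact hy
  rw [← hfull, mem_image] at hmem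
  obtain ⟨j, -, hj⟩ := hmem
  exact ⟨j, hj.symm⟩

omit V in
/-- `L` has characteristic `2`. [folklore] -/
theorem charP_LF : CharP (LF cap a M d) 2 := by
  haveI : CharP (GF2 M) 2 := GF2.charP M
  exact charP_of_injective_algebraMap (algebraMap (GF2 M) (LF cap a M d)).injective 2

/-- **`root^{hⁱ}` is a Frobenius-power conjugate of `root`**, the same power iterated. [cite: Umans2003, §3, Lemma 7] -/
theorem root_pow_h_pow : ∃ j₀ : ℕ, ∀ i : ℕ, AdjoinRoot.root (pOf M (pcOf cap a M d)) ^ ((2 ^ a) ^ i) =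
    (frob cap a M d ^ (i * j₀)) (AdjoinRoot.root (pOf M (pcOf cap a M d))) := by
  haveI : Fact (Nat.Prime 2) := ⟨Nat.prime_two⟩
  haveI : CharP (LF cap a M d) 2 := charP_LF
  set rt := AdjoinRoot.root (pOf M (pcOf cap a M d)) with hrt
  -- `root^h` is a root of the modulus
  have h0 : ((pOf M (pcOf cap a M d)).map (algebraMap (GF2 M) (LF cap a M d))).eval rt = 0 := by
    rw [eval_map, AdjoinRoot.algebraMap_eq, hrt, AdjoinRoot.eval₂_root]
  have h1 := UmansField.eval_pow_of_coeff_pow 2 (n := a) (fun j => V.coeff_pOf_pow j) h0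
  obtain ⟨j₀, hj₀⟩ := V.root_of_eval_eq_zero h1
  refine ⟨j₀, fun i => ?_⟩
  induction i with
  | zero => rw [pow_zero, pow_one, Nat.zero_mul, pow_zero, AlgEquiv.one_apply]
  | succ i ih =>
    rw [pow_succ, pow_mul, ih, ← map_pow, hj₀, ← AlgEquiv.mul_apply, ← pow_add, Nat.succ_mul]

/-- **`root^{h^d} = root`.** [cite: Umans2003, §3, Lemma 7] -/
theorem root_pow_h_pow_d : AdjoinRoot.root (pOf M (pcOf cap a M d)) ^ ((2 ^ a) ^ d) = AdjoinRoot.root (pOf M (pcOf cap a M d)) := by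
  obtain ⟨j₀, hj⟩ := V.root_pow_h_pow
  rw [hj d, pow_mul, V.frob_pow_d, one_pow, AlgEquiv.one_apply]

/-- **The grid**: the elements with `F_h`-coordinates. [cite: Umans2003, §4.1 (the subcube `F_h^d`)] -/
def grid : Finset (LF cap a M d) := by
  classical exact univ.image (UmansEnc.gridPt (NB V.hlen) (HF cap a M))

/-- **The grid has `h^d` points.** [cite: Umans2003, §4.1] -/
theorem card_grid : V.grid.card = (2 ^ a) ^ d := by
  classical
  rw [grid, card_image_of_injective _ (UmansEnc.gridPt_injective _ _), card_univ, Fintype.card_pi, Finset.prod_const, card_univ,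
    Fintype.card_coe, V.card_HF, Fintype.card_fin]

/-- **Grid points are fixed by `x ↦ x^{h^d}`** (they form the subfield `F_{h^d}`). [cite: Umans2003, §4.1] -/
theorem grid_pow {y : LF cap a M d} (hy : y ∈ V.grid) : y ^ ((2 ^ a) ^ d) = y := by
  classical
  haveI : Fact (Nat.Prime 2) := ⟨Nat.prime_two⟩
  haveI : CharP (LF cap a M d) 2 := charP_LF
  rw [grid, mem_image] at hy
  obtain ⟨c, -, rfl⟩ := hy
  have hφ : ∀ x : LF cap a M d, x ^ ((2 ^ a) ^ d) = iterateFrobenius (LF cap a M d) 2 (a * d) x := fun x => by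
    rw [iterateFrobenius_def, pow_mul]
  rw [hφ, UmansEnc.gridPt, map_sum]
  refine Finset.sum_congr rfl fun i _ => ?_
  rw [Algebra.smul_def, map_mul]
  -- coordinates in `F_h` are fixed by `x ↦ x^h`, hence by `x ↦ x^{h^d}`
  have hc : ((c i : GF2 M)) ^ (2 ^ a) = c i := V.mem_HF.1 (c i).2
  have hck : ∀ k : ℕ, ((c i : GF2 M)) ^ ((2 ^ a) ^ k) = c i := fun k => by
    induction k with
    | zero => rw [pow_zero, pow_one]
    | succ k ih => rw [pow_succ, pow_mul, ih, hc]
  congr 1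
  · rw [iterateFrobenius_def, ← map_pow, pow_mul, hck d]
  · rw [← hφ, NB_apply, ← pow_mul, mul_comm, pow_mul, V.root_pow_h_pow_d]

/-- **An element fixed by `x ↦ x^{h^d}` is a grid point** (counting roots of `X^{h^d} - X`). [cite: Umans2003, §4.1] -/
theorem mem_grid_of_pow {y : LF cap a M d} (hy : y ^ ((2 ^ a) ^ d) = y) : y ∈ V.grid := by
  classical
  set R : (LF cap a M d)[X] := X ^ ((2 ^ a) ^ d) - X with hR
  have h1 : 1 < (2 ^ a) ^ d := Nat.one_lt_pow (by have := V.hd; omega) (Nat.one_lt_two_pow (by have := V.ha; omega))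
  have hR0 : R ≠ 0 := FiniteField.X_pow_card_sub_X_ne_zero _ h1
  have hdeg : R.natDegree = (2 ^ a) ^ d := FiniteField.X_pow_card_sub_X_natDegree_eq _ h1
  have hsub : V.grid ⊆ R.roots.toFinset := fun z hz => by
    rw [Multiset.mem_toFinset, mem_roots hR0, IsRoot.def, hR, eval_sub, eval_pow, eval_X, V.grid_pow hz, sub_self]
  have hfull : V.grid = R.roots.toFinset := eq_of_subset_of_card_le hsub (by
    rw [V.card_grid]; exact (Multiset.toFinset_card_le _).trans ((card_roots' R).trans hdeg.le))
  rw [hfull, Multiset.mem_toFinset, mem_roots hR0, IsRoot.def, hR, eval_sub, eval_pow, eval_X, hy, sub_self]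

/-! ### The positions `γᵏ` -/

omit hirr in
/-- `h^d - 1` divides `q^d - 1`. [folklore] -/
theorem T_dvd_P : (2 ^ a) ^ d - 1 ∣ (2 ^ (M + 1)) ^ d - 1 := by
  have e : (2 ^ (M + 1)) ^ d = ((2 ^ a) ^ d) ^ c0 := by
    rw [V.hM, ← pow_mul, ← pow_mul, ← pow_mul, Nat.mul_right_comm, Nat.mul_assoc]
  rw [e]
  exact Nat.sub_one_dvd_pow_sub_one _ _

/-- The exponent `r = (q^d - 1)/(h^d - 1)`. [cite: Umans2003, §4.1 ("location `α^{ri}`")] -/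
def _root_.Literature.Computability.Complexity.UmansFP.rOf (a M d : ℕ) : ℕ := ((2 ^ (M + 1)) ^ d - 1) / ((2 ^ a) ^ d - 1)

omit hirr in
/-- `r (h^d - 1) = q^d - 1`. [folklore] -/
theorem r_mul_T : rOf a M d * ((2 ^ a) ^ d - 1) = (2 ^ (M + 1)) ^ d - 1 := Nat.div_mul_cancel V.T_dvd_P

omit V hirr in
/-- `r ≤ q^d - 1 < 2^{d(M+1)+1}`. [folklore] -/
theorem _root_.Literature.Computability.Complexity.UmansFP.r_lt : rOf a M d < 2 ^ (d * (M + 1) + 1) := by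
  refine (Nat.div_le_self _ _).trans_lt ?_
  calc (2 ^ (M + 1)) ^ d - 1 < (2 ^ (M + 1)) ^ d := Nat.sub_lt (Nat.pow_pos (Nat.two_pow_pos _)) Nat.one_pos
    _ = 2 ^ (d * (M + 1)) := by rw [← pow_mul, mul_comm]
    _ < 2 ^ (d * (M + 1) + 1) := Nat.pow_lt_pow_right (by norm_num) (Nat.lt_succ_self _)

/-- **The element `γ = α^r` found by the program.** [cite: Umans2003, §4.1] -/
theorem γ_spec : LRep M d (γOf cap a M d) ∧ lElt M (pcOf cap a M d) (γOf cap a M d) = αL cap a M d ^ rOf a M d := by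
  have hpc := V.pc_spec.1
  have h := lpowB_spec M hpc V.hd V.α_spec.1 (z := rOf a M d) (B := d * (M + 1) + 1) r_lt
  rw [γOf, V.ctxOf_eq, qOf]
  exact ⟨h.1, h.2⟩

/-- **`γ` as an element of `L`.** [cite: Umans2003, §4.1] -/
def _root_.Literature.Computability.Complexity.UmansFP.γL (cap a M d : ℕ) [Fact (Irreducible (pOf M (pcOf cap a M d)))] : LF cap a M d :=
  lElt M (pcOf cap a M d) (γOf cap a M d)

/-- `γ = α^r`. [cite: Umans2003, §4.1] -/
theorem γL_eq : γL cap a M d = αL cap a M d ^ rOf a M d := V.γ_spec.2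

/-- **`γ^{h^d - 1} = 1`.** [cite: Umans2003, §4.1] -/
theorem γL_pow_T : γL cap a M d ^ ((2 ^ a) ^ d - 1) = 1 := by rw [V.γL_eq, ← pow_mul, V.r_mul_T, V.αL_pow_P]

/-- **The powers of `γ` lie on the grid.** [cite: Umans2003, §4.1 ("we embed `x_i` at location `α^{ri}` … `F_h^d`")] -/
theorem γL_pow_mem_grid (k : ℕ) : γL cap a M d ^ k ∈ V.grid := by
  apply V.mem_grid_of_pow
  have hT : (2 ^ a) ^ d = ((2 ^ a) ^ d - 1) + 1 := (Nat.sub_add_cancel (Nat.one_le_pow _ _ (Nat.pow_pos (by norm_num)))).symm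
  rw [← pow_mul, hT, Nat.mul_succ, pow_add, mul_comm k, pow_mul, V.γL_pow_T, one_pow, one_mul]

/-- **The powers `γ⁰, …, γ^{h^d - 2}` are distinct.** [cite: Umans2003, §4.1] -/
theorem γL_pow_injOn {i j : ℕ} (hi : i < (2 ^ a) ^ d - 1) (hj : j < (2 ^ a) ^ d - 1) (h : γL cap a M d ^ i = γL cap a M d ^ j) : i = j := by
  rw [V.γL_eq, ← pow_mul, ← pow_mul] at h
  have hr : 0 < rOf a M d := Nat.pos_of_ne_zero fun h0 => by
    have := V.r_mul_T; rw [h0, Nat.zero_mul] at this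
    have : 1 < (2 ^ (M + 1)) ^ d := Nat.one_lt_pow (by have := V.hd; omega) (Nat.one_lt_two_pow (by omega))
    omega
  have h1 : rOf a M d * i < (2 ^ (M + 1)) ^ d - 1 := by rw [← V.r_mul_T]; exact (Nat.mul_lt_mul_left hr).2 hi
  have h2 : rOf a M d * j < (2 ^ (M + 1)) ^ d - 1 := by rw [← V.r_mul_T]; exact (Nat.mul_lt_mul_left hr).2 hj
  exact Nat.eq_of_mul_eq_mul_left hr (V.αL_pow_injOn h1 h2 h)

/-- **The positions** `pos k = γᵏ`, `k < n`. [cite: Umans2003, §4.1] -/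
def _root_.Literature.Computability.Complexity.UmansFP.posF (cap a M d : ℕ) [Fact (Irreducible (pOf M (pcOf cap a M d)))] (n : ℕ) (k : Fin n) : LF cap a M d :=
  γL cap a M d ^ (k : ℕ)

/-- The positions are distinct (for `n ≤ h^d - 1`). [cite: Umans2003, §4.1] -/
theorem pos_injective {n : ℕ} (hn : n ≤ (2 ^ a) ^ d - 1) : Function.Injective (posF cap a M d n) := fun k k' h =>
  Fin.ext (V.γL_pow_injOn (k.2.trans_le hn) (k'.2.trans_le hn) h)

/-- The positions are grid points. [cite: Umans2003, §4.1] -/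
theorem pos_grid (n : ℕ) (k : Fin n) : ∃ c : Fin d → HF cap a M, posF cap a M d n k = UmansEnc.gridPt (NB V.hlen) (HF cap a M) c := by
  classical
  have := V.γL_pow_mem_grid k
  rw [grid, mem_image] at this
  obtain ⟨c, -, hc⟩ := this
  exact ⟨c, hc.symm⟩

/-- The program's position list lists `pos`. [cite: Umans2003, §4.1] -/
theorem positionsL_pos (n : ℕ) :
    (positionsL (kctx M) (pcOf cap a M d) (γOf cap a M d) n).length = n ∧
      ∀ k : Fin n, LRep M d ((positionsL (kctx M) (pcOf cap a M d) (γOf cap a M d) n).getD k []) ∧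
        lElt M (pcOf cap a M d) ((positionsL (kctx M) (pcOf cap a M d) (γOf cap a M d) n).getD k []) = posF cap a M d n k := by
  obtain ⟨h1, h2⟩ := positionsL_spec V.pc_spec.1 V.hd V.γ_spec.1 n
  exact ⟨h1, fun k => h2 k k.2⟩

end Grid

/-! ### The program's evaluations are the encoding `Ẽ` and the binary generator -/

section Enc

variable {cap a M d c0 : ℕ} [hirr : Fact (Irreducible (pOf M (pcOf cap a M d)))]
variable (V : PrmOK cap a M d c0)

/-- **The table as field values**: `x_k ∈ {0, 1} ⊆ K`. [cite: Umans2003, §4.1] -/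
def _root_.Literature.Computability.Complexity.UmansFP.tabK (M : ℕ) (xs : List Bool) (k : Fin xs.length) : GF2 M :=
  if xs.getD k false then 1 else 0

include V

/-- **The Lagrange extension `φ` of the placed table.** [cite: Umans2003, §4.1, eq. (2), Thm. 8] -/
def φF (xs : List Bool) : LF cap a M d → GF2 M := by
  classical exact UmansEnc.lde (NB V.hlen) (HF cap a M) (UmansEnc.placedTable (NB V.hlen) (HF cap a M) (posF cap a M d xs.length) (tabK M xs))

/-- **The augmented encoding `Ẽ = augE β φ`.** [cite: Umans2003, §4.2, Def. 9] -/
def EF (xs : List Bool) : LF cap a M d → LF cap a M d := UmansEnc.augE (βL cap a M d) (V.φF xs)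

/-- **`φ` reads the table at the positions**: `φ(γᵏ) = x_k` (`n ≤ h^d - 1`). [cite: Umans2003, §4.1, Thm. 8 (P2)] -/
theorem φF_pos {xs : List Bool} (hn : xs.length ≤ (2 ^ a) ^ d - 1) (k : Fin xs.length) : V.φF xs (posF cap a M d xs.length k) = tabK M xs k := by
  classical
  rw [φF]
  exact UmansEnc.lde_placedTable _ _ (V.pos_injective hn) (V.pos_grid xs.length) _ k

/-- The program's position lists have entries in the `F_h`-list (their values are grid points). [cite: Umans2003, §4.1] -/
theorem positionsL_mem_Hl (n : ℕ) (k : Fin n) : ∀ x ∈ (positionsL (kctx M) (pcOf cap a M d) (γOf cap a M d) n).getD k [], x ∈ HlOf cap a M := by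
  obtain ⟨-, hk⟩ := V.positionsL_pos n
  obtain ⟨hrep, hval⟩ := hk k
  obtain ⟨c, hc⟩ := V.pos_grid n k
  intro x hx
  obtain ⟨i, hi, rfl⟩ := List.getElem_of_mem hx
  have hid : i < d := by rw [← hrep.1]; exact hi
  refine V.mem_HlOf.2 ⟨hrep.2 _ hx, ?_⟩
  have hco := coord_lElt V.hlen hrep.1.le ⟨i, hid⟩
  rw [List.getD_eq_getElem _ _ hi] at hco
  rw [← hco, hval, hc, UmansEnc.coord_gridPt]
  exact V.mem_HF.1 (c ⟨i, hid⟩).2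

/-- **The program computes `φ`**: on a reduced list `u`, `elt (ldeEvalL …) = φ(lElt u)`.
[cite: Umans2003, §4.1, eq. (2), Thm. 8] -/
theorem elt_ldeEvalL_eq (xs : List Bool) (hn : xs.length ≤ (2 ^ a) ^ d - 1) {u : List ℕ} (hu : LRep M d u) :
    GF2.elt M (ldeEvalL (kctx M) (HlOf cap a M) (positionsL (kctx M) (pcOf cap a M d) (γOf cap a M d) xs.length) xs u) =
      V.φF xs (lElt M (pcOf cap a M d) u) := by
  classical
  set n := xs.length with hndef
  set posL := positionsL (kctx M) (pcOf cap a M d) (γOf cap a M d) n with hposL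
  obtain ⟨hlenP, hposk⟩ := V.positionsL_pos n
  have hpos : ∀ k, (hk : k < n) → LRep M d (posL.getD k []) ∧ ∀ x ∈ posL.getD k [], x ∈ HlOf cap a M := fun k hk =>
    ⟨(hposk ⟨k, hk⟩).1, V.positionsL_mem_Hl n ⟨k, hk⟩⟩
  rw [(elt_ldeEvalL V.HlOf_lt V.HlOf_nodup hlenP hpos xs hu).1]
  -- the right-hand side: `lde` of the placed table, reindexed over the positions
  rw [φF, UmansEnc.lde]
  -- grid indices of the positions
  have hgrid := V.pos_grid n
  choose ck hck using hgrid
  have hck_inj : Function.Injective ck := fun k k' h => V.pos_injective hn (by rw [hck k, hck k', h])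
  -- the placed table vanishes off the image of `ck` and reads `tabK` on it
  have htab_on : ∀ k : Fin n, UmansEnc.placedTable (NB V.hlen) (HF cap a M) (posF cap a M d n) (tabK M xs) (ck k) = tabK M xs k := by
    intro k
    rw [UmansEnc.placedTable]
    have hex : ∃ k' : Fin n, posF cap a M d n k' = UmansEnc.gridPt (NB V.hlen) (HF cap a M) (ck k) := ⟨k, hck k⟩
    show (if h : ∃ k' : Fin n, posF cap a M d n k' = UmansEnc.gridPt (NB V.hlen) (HF cap a M) (ck k) then tabK M xs (Classical.choose h) else 0) = _
    rw [dif_pos hex]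
    congr 1
    exact V.pos_injective hn ((Classical.choose_spec hex).trans (hck k).symm)
  have htab_off : ∀ c : Fin d → HF cap a M, c ∉ univ.image ck →
      UmansEnc.placedTable (NB V.hlen) (HF cap a M) (posF cap a M d n) (tabK M xs) c = 0 := by
    intro c hc
    rw [UmansEnc.placedTable]
    show (if h : ∃ k' : Fin n, posF cap a M d n k' = UmansEnc.gridPt (NB V.hlen) (HF cap a M) c then tabK M xs (Classical.choose h) else 0) = _
    rw [dif_neg]
    rintro ⟨k, hk⟩
    exact hc (mem_image.2 ⟨k, mem_univ _, UmansEnc.gridPt_injective _ _ ((hck k).symm.trans hk)⟩)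
  rw [← Finset.sum_subset (subset_univ (univ.image ck)) fun c _ hc => by rw [htab_off c hc, zero_mul],
    Finset.sum_image fun k _ k' _ h => hck_inj h]
  refine Finset.sum_congr rfl fun k _ => ?_
  rw [htab_on, tabK]
  have hterm : ∀ i : Fin d, (UmansEnc.lagr (HF cap a M) (ck k i)).eval ((NB V.hlen).coord i (lElt M (pcOf cap a M d) u)) =
      (Lagrange.basis (((HlOf cap a M).map (GF2.elt M)).toFinset) id (GF2.elt M ((posL.getD k []).getD i 0))).eval (GF2.elt M (u.getD i 0)) := by
    intro i
    rw [coord_lElt V.hlen hu.1.le, UmansEnc.lagr]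
    congr 2
    -- `(ck k i : K) = coord_i (pos k) = elt (posL_k,i)`
    have h1 : ((ck k i : GF2 M)) = (NB V.hlen).coord i (posF cap a M d n k) := by rw [hck k, UmansEnc.coord_gridPt]
    rw [h1, ← (hposk k).2, coord_lElt V.hlen (hposk k).1.1.le]
  simp_rw [hterm]
  split_ifs
  · rw [one_mul]
  · rw [zero_mul]

/-- **The program computes `Ẽ`**: on a reduced list `u`, `lElt (augEvalL …) = Ẽ(lElt u)`. [cite: Umans2003, §4.2, Def. 9] -/
theorem lElt_augEvalL_eq (xs : List Bool) (hn : xs.length ≤ (2 ^ a) ^ d - 1) {u : List ℕ} (hu : LRep M d u) :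
    LRep M d (augEvalL (kctx M) (pcOf cap a M d) (M + 1) (HlOf cap a M) (positionsL (kctx M) (pcOf cap a M d) (γOf cap a M d) xs.length) xs
      (βOf cap a M d) u) ∧
    lElt M (pcOf cap a M d) (augEvalL (kctx M) (pcOf cap a M d) (M + 1) (HlOf cap a M)
      (positionsL (kctx M) (pcOf cap a M d) (γOf cap a M d) xs.length) xs (βOf cap a M d) u) = V.EF xs (lElt M (pcOf cap a M d) u) := by
  classical
  have hpc := V.pc_spec.1
  obtain ⟨hlenP, hposk⟩ := V.positionsL_pos xs.length
  have hpos : ∀ k, (hk : k < xs.length) → LRep M d ((positionsL (kctx M) (pcOf cap a M d) (γOf cap a M d) xs.length).getD k []) ∧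
      ∀ x ∈ (positionsL (kctx M) (pcOf cap a M d) (γOf cap a M d) xs.length).getD k [], x ∈ HlOf cap a M := fun k hk =>
    ⟨(hposk ⟨k, hk⟩).1, V.positionsL_mem_Hl xs.length ⟨k, hk⟩⟩
  obtain ⟨h1, h2⟩ := lElt_augEvalL hpc V.hd (M + 1) V.HlOf_lt V.HlOf_nodup hlenP hpos xs V.β_spec.1 hu
  refine ⟨h1, ?_⟩
  rw [h2, EF, UmansEnc.augE, ← Equiv.sum_comp V.galEquiv]
  refine Finset.sum_congr rfl fun j _ => ?_
  obtain ⟨hs1, hs2⟩ := lsqIter_spec M hpc V.hd hu ((M + 1) * (d - j))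
  rw [V.elt_ldeEvalL_eq xs hn hs1, hs2, Algebra.smul_def, AdjoinRoot.algebraMap_eq, galEquiv_apply, V.frob_pow_symm, frob_pow_apply,
    frob_pow_apply, ← βL, pow_mul, pow_mul]

omit V hirr in
/-- **The codeword bit of a represented symbol is the program's bit**: `C(z)_{(a, y)} = hadB (keval sym a) y`
for the coefficient vector `z` of the reduced list `sym`. [cite: Umans2003, Lemma 13 (the code `C`)] -/
theorem _root_.Literature.Computability.Complexity.UmansFP.cw_list {sym : List ℕ} (hsym : LRep M d sym) {av yv : ℕ} (ha : av < 2 ^ (M + 1)) (hy : yv < 2 ^ (M + 1)) :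
    QConv.cw (labM M) (fun j : Fin d => GF2.elt M (sym.getD j 0)) (GF2.elt M av, ⟨yv, hy⟩) = hadB (M + 1) (keval (kctx M) sym av) yv := by
  rw [QConv.cw, symPoly_coeffVec hsym.1]
  obtain ⟨hv, hlt⟩ := keval_spec ha hsym.2
  rw [← hv]
  show MetaComplexity.LDC.hadN (M + 1) (toBits M (GF2.elt M (keval (kctx M) sym av))) yv = _
  rw [toBits_elt M hlt, hadN_eq]

/-- **The `q^d`-ary generator as coefficient vectors**: `G(y)_k =` coordinates of `Ẽ(α^{k+1} y)`.
[cite: Umans2003, §5, Thm. 14, eq. (7)] -/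
def GF (xs : List Bool) (m : ℕ) (y : LF cap a M d) (k : Fin m) : Fin d → GF2 M :=
  fun j => (NB V.hlen).coord j (UmansEnc.qGen (βL cap a M d) (V.φF xs) (αL cap a M d) m y k)

/-- **The core generator outputs the binary generator's bits**: on the seed blocks `(y, a, v)` parsed
from `seed`, bit `i < m` of `genCoreL` is `binGen (labM) G ((y, (a, v))) i`. [cite: Umans2003, Lemma 13, Thm. 14 eq. (7), Thm. 6] -/
theorem genCoreL_getD (xs : List Bool) (hn : xs.length ≤ (2 ^ a) ^ d - 1) (m : ℕ) (seed : List Bool) (i : Fin m) :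
    let prs := parseL (M + 1) (d + 2) seed
    (genCoreL cap xs m seed a M d).length = m ∧
    ∀ (hy : prs.getD (d + 1) 0 < 2 ^ (M + 1)),
      (genCoreL cap xs m seed a M d).getD i false =
        QConv.binGen (labM M) (V.GF xs m) (lElt M (pcOf cap a M d) (prs.take d), (GF2.elt M (prs.getD d 0), ⟨prs.getD (d + 1) 0, hy⟩)) i := by
  intro prs
  have hpc := V.pc_spec.1
  obtain ⟨hplen, hplt⟩ := parseL_spec (M + 1) (d + 2) seed
  have hyu : LRep M d (prs.take d) := ⟨by rw [List.length_take, hplen]; omega, fun x hx => hplt x (List.mem_of_mem_take hx)⟩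
  have hav : prs.getD d 0 < 2 ^ (M + 1) := by
    rw [List.getD_eq_getElem _ _ (by rw [hplen]; omega)]; exact hplt _ (List.getElem_mem _)
  -- unfold the core
  have hcore : genCoreL cap xs m seed a M d = genBitsL (kctx M) (M + 1)
      (symbolsL (kctx M) (pcOf cap a M d) (M + 1) (HlOf cap a M) (positionsL (kctx M) (pcOf cap a M d) (γOf cap a M d) xs.length) xs
        (βOf cap a M d) (αOf cap a M d) (prs.take d) m) (prs.getD d 0) (prs.getD (d + 1) 0) := by
    rw [genCoreL]; simp only [V.ctxOf_eq]; rfl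
  set syms := symbolsL (kctx M) (pcOf cap a M d) (M + 1) (HlOf cap a M) (positionsL (kctx M) (pcOf cap a M d) (γOf cap a M d) xs.length) xs
        (βOf cap a M d) (αOf cap a M d) (prs.take d) m with hsyms
  obtain ⟨hslen, hsget⟩ := symbolsL_spec (kctx M) (pcOf cap a M d) (M + 1) (HlOf cap a M)
    (positionsL (kctx M) (pcOf cap a M d) (γOf cap a M d) xs.length) xs (βOf cap a M d) (αOf cap a M d) (prs.take d) m
  obtain ⟨hblen, hbget⟩ := genBitsL_spec (kctx M) (M + 1) syms (prs.getD d 0) (prs.getD (d + 1) 0)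
  refine ⟨by rw [hcore, hblen, hslen], fun hy => ?_⟩
  rw [hcore, hbget i (by rw [hslen]; exact i.2), hsget i i.2]
  obtain ⟨ho1, ho2⟩ := orbitL_spec hpc V.hd V.α_spec.1 hyu i
  obtain ⟨he1, he2⟩ := V.lElt_augEvalL_eq xs hn ho1
  rw [QConv.binGen]
  simp only []
  rw [← cw_list he1 hav hy]
  congr 1
  funext j
  rw [GF, ← coord_lElt V.hlen he1.1.le j, he2, UmansEnc.qGen, ho2, αL, EF]

end Enc

end PrmOK

end UmansFP

end Literature.Computability.Complexity

end
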